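import Summits.CriticalPhenomena.PercolationContinuityZ3.Theorems.Transplant.FKConnectivityAllQClusterDomAssoc
import Summits.CriticalPhenomena.PercolationContinuityZ3.Theorems.Transplant.FKConnectivityAllQEdgeLocal
import Summits.CriticalPhenomena.PercolationContinuityZ3.Theorems.Transplant.FKConnectivityAllQLoops
import Summits.CriticalPhenomena.PercolationContinuityZ3.Theorems.Transplant.FKConnectivityAllQHubCovEquiv
import HarnessLib

/-!
# Connectivity correlation inequalities for `φ_{w,q}`, every `q > 0` — negative correlation of ADJACENT edges already implies
# the hub inequality (Ayyer–Linusson–Ravichandran (13)): only pairs AT the weight-1 cluster of the hub are ever revealed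

Support file (`--supports stmt-CriticalPhenomena-4575`), census seat `prim-bschramm-census` (gen 19) of the post-continuity
programme; builds on p205010 (kernel theorem, internal audit signed; external expert review pending).  No definitions, no named
facts, no sorries; standard axioms.

THEOREM (`hubUnder_of_edgeNegCorrAdjOn`, `0 < q < 1`): if on the vertex type `V` every two ADJACENT nondiagonal pairs are negatively
correlated under every `φ_{w,q}` (fk-1 g4's node `FK.EdgeNegCorrAdjOn V q` — the adjacent case of Grimmett's negative-correlation
conjecture, equivalently fk-3's hub covariance bound `HubCovBoundFK`), then the hub inequality `φ(o ↔ a)·φ(b ↔ a) ≤ φ(o ↔ a ↔ b)` holds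
for every `w` (`FK.HubUnder`).  Node form: **`hubFKPos_of_edgeNegCorrAdjFKLtOne : EdgeNegCorrAdjFKLtOne → HubFKPos`** and
`hubFKPos_of_hubCovBoundFKLtOne` — Ayyer–Linusson–Ravichandran's printed open inequality (13) (their Conj. 7.1 in the arboreal-gas
reading) follows from the ADJACENT case alone of edge negative correlation; the tree so far derived `HubFKPos` from the full
single-edge monotonicity EC⁺ for ALL pairs (fk-2 g6, `hubFKPos_of_edgeConnMonoFKPos`), from cluster association CA or from MM (fk-1 g7/g8).

PROOF.  fk-1 g8's Harris induction for `MM ⇒ CA` (`clusterAssoc_of_clusterDomAdj_aux`), run for the two PRINCIPAL up-sets `{S ∋ a}`,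
`{S ∋ b}` only: induct on the number of undetermined pairs; if an undetermined pair `f ∋ v` meets the weight-1 cluster of the hub `x`
at `v`, decompose `φ_w = φ_w(f)φ_{w[f↦1]} + (1 − φ_w(f))φ_{w[f↦0]}`; the cross term needs only `φ_{w[f↦0]}(v ↔ a) ≤ φ_{w[f↦1]}(v ↔ a)`
(and the same for `b`) — EC⁺ for a pair AT `v`, which is ONE instance of adjacent negative correlation (pairs `s(v,a)` and `f`, common
vertex `v`) through fk-2's local master identity `edgeConnMono_of_negCorr_at`; a diagonal `f = s(v,v)` is an independent coin
(fk-3's `rcMeasureW_real_inter_loop`).  If no undetermined pair meets the cluster, `C_x` is deterministic.  For `q ≥ 1` the hub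
inequality is FKG (`clusterAssocFK_of_one_le`).  Found while reading the census seat's forest-level census (gen 19 memo
HOME/FROM-census-g19-FOREST-COEF.md §4: in the arboreal gas the same induction gives 'adjacent Kahn–Grimmett–Winkler ⇒ ALR Conj 7.1').
[cite: Grimmett2006, Thm. (3.7) (p. 39); §3.9 eq. (3.94) (pp. 63–65)]
[cite: AyyerLinussonRavichandran2025, §7 eq. (13)–(15), Conj. 7.1 (pp. 22–23)]
-/

noncomputable section

namespace Summit.CriticalPhenomena.PercolationContinuityZ3.Theorems

namespace FK

open MeasureTheory Set Literature.Probability.LatticeModels Literature.Probability.Percolation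
open scoped Classical
open BHK2006 DecisionTree HullPort

variable {V : Type*} [Fintype V]

/-- **EC⁺ at a vertex from adjacent negative correlation** (`0 < q < 1`): under `EdgeNegCorrAdjOn V q`, for every weight vector
`w`, every pair `f ∋ v` and every vertex `a`, opening `f` does not lower `φ(v ↔ a)`:
`φ_{w[f↦0],q}(v ↔ a) ≤ φ_{w[f↦1],q}(v ↔ a)`.  (A diagonal `f = s(v,v)` is an independent coin.)
[cite: Grimmett2006, §3.9 eq. (3.94) (p. 63); Thm. (3.1)(a) (p. 37)] -/
theorem edgeConnMono_at_vertex_of_edgeNegCorrAdjOn {q : ℝ} (hq0 : 0 < q) (hq1 : q < 1) (hNC : EdgeNegCorrAdjOn V q)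
    (w : Sym2 V → unitInterval) {f : Sym2 V} {v : V} (hvf : v ∈ f) (a : V) :
    (rcMeasureW (Function.update w f 0) q ∅).real (openConn v a) ≤
      (rcMeasureW (Function.update w f 1) q ∅).real (openConn v a) := by
  set half : unitInterval := ⟨2⁻¹, by norm_num, by norm_num⟩ with hhalf
  refine edgeConnMono_of_negCorr_at hq0 hq1 w f v a half (by norm_num [hhalf]) (by norm_num [hhalf]) fun hva hfe => ?_
  have hf : f = s(v, Sym2.Mem.other hvf) := (Sym2.other_spec hvf).symm
  by_cases hfd : f.IsDiag
  · -- `f` is the loop at `v`: independent of `J_{va}`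
    have hvv : Sym2.Mem.other hvf = v := by
      have h := hfd; rw [hf, Sym2.mk_isDiag_iff] at h; exact h.symm
    rw [hvv] at hf
    rw [hf]
    rw [hf] at hfe
    exact (rcMeasureW_real_inter_loop _ hq0 v (e := s(v, a)) (Ne.symm hfe)).le
  · exact hNC _ s(v, a) f (by rw [Sym2.mk_isDiag_iff]; exact hva) hfd hfe ⟨v, Sym2.mem_mk_left v a, hvf⟩

/-- **Adjacent NC ⇒ the hub inequality, inductive form** (`0 < q < 1`): under `EdgeNegCorrAdjOn V q`, for every parameter vector
with `n` undetermined pairs and every hub `x`, `φ(x ↔ a)·φ(x ↔ b) ≤ φ(x ↔ a, x ↔ b)`.  (fk-1 g8's `clusterAssoc_of_clusterDomAdj_aux`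
for the principal up-sets `{S ∋ a}`, `{S ∋ b}`; the cross term uses EC⁺ at the vertex `v` of the weight-1 cluster only.)
[cite: Grimmett2006, Thm. (2.19) proof (pp. 26–27); Thm. (3.7) (p. 39); §3.9 (pp. 63–65)] -/
theorem hub_of_edgeNegCorrAdj_aux {q : ℝ} (hq0 : 0 < q) (hq1 : q < 1) (hNC : EdgeNegCorrAdjOn V q) :
    ∀ (n : ℕ) (w : Sym2 V → unitInterval), (undet w).card = n → ∀ (x a b : V),
      (rcMeasureW w q ∅).real (clusterIn x {S | a ∈ S}) * (rcMeasureW w q ∅).real (clusterIn x {S | b ∈ S}) ≤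
        (rcMeasureW w q ∅).real (clusterIn x {S | a ∈ S} ∩ clusterIn x {S | b ∈ S}) := by
  intro n
  induction n using Nat.strong_induction_on with
  | _ n ih =>
    intro w hn x a b
    by_cases hcase : ∃ f ∈ cut {x} (oneSet w), f ∈ undet w
    · -- an undetermined pair `f ∋ v` meets the weight-1 cluster of `x` at `v`
      obtain ⟨f, ⟨v, hvf, x', hx', hxv⟩, hfu⟩ := hcase
      rw [mem_singleton_iff] at hx'
      subst hx'
      have hw1 : w f ≠ 1 := fun h1 => (mem_undet_iff w f).1 hfu (Or.inr h1)
      -- `C_x = C_v` a.s. under `w`, `w[f↦1]`, `w[f↦0]`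
      have reach : ∀ bb : Bool, (openGraph (oneSet (setW w f bb))).Reachable x' v := fun bb =>
        hxv.mono (openGraph_le (oneSet_subset_oneSet_setW w hw1 bb))
      -- one-point decompositions
      have eA := real_opd w hq0 f (clusterIn x' {S | a ∈ S})
      have eB := real_opd w hq0 f (clusterIn x' {S | b ∈ S})
      have eAB := real_opd w hq0 f (clusterIn x' {S | a ∈ S} ∩ clusterIn x' {S | b ∈ S})
      -- induction hypothesis for the two revealed vectors
      have hlt : ∀ bb : Bool, (undet (setW w f bb)).card < n := fun bb => by
        have h1 := card_undet_setW_le w hfu bb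
        have hpos : 0 < (undet w).card := Finset.card_pos.2 ⟨f, hfu⟩
        omega
      have ih1 := ih _ (hlt true) (setW w f true) rfl x' a b
      have ih0 := ih _ (hlt false) (setW w f false) rfl x' a b
      -- EC⁺ at `v` (from adjacent NC), transported to `x'`
      have mm : ∀ c : V, (rcMeasureW (setW w f false) q ∅).real (clusterIn x' {S | c ∈ S}) ≤
          (rcMeasureW (setW w f true) q ∅).real (clusterIn x' {S | c ∈ S}) := fun c => by
        rw [real_clusterIn_eq_of_oneSet_reachable _ hq0 (reach false) {S | c ∈ S},
          real_clusterIn_eq_of_oneSet_reachable _ hq0 (reach true) {S | c ∈ S}, setW_false_eq, setW_true_eq,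
          clusterIn_mem_eq_openConn]
        exact edgeConnMono_at_vertex_of_edgeNegCorrAdjOn hq0 hq1 hNC w hvf c
      rw [eA, eB, eAB]
      exact assoc_step (popen_nonneg w hq0 f) (popen_le_one w hq0 f) ih1 ih0 (mm a) (mm b)
    · -- no undetermined pair meets the weight-1 cluster: `C_x` is deterministic
      push Not at hcase
      have hA : ∀ f ∈ cut {x} (oneSet w), w f = 0 ∨ w f = 1 := fun f hf => by
        have := hcase f hf; rw [mem_undet_iff] at this; push Not at this
        exact this
      have hinter : clusterIn x {S | a ∈ S} ∩ clusterIn x {S | b ∈ S} = clusterIn x ({S | a ∈ S} ∩ {S | b ∈ S}) := by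
        ext ω; simp [clusterIn]
      rw [hinter, real_clusterIn_of_determined w hq0 x hA {S | a ∈ S}, real_clusterIn_of_determined w hq0 x hA {S | b ∈ S},
        real_clusterIn_of_determined w hq0 x hA ({S | a ∈ S} ∩ {S | b ∈ S}), ind_inter]

/-- **Negative correlation of adjacent edges ⇒ the hub inequality** on the vertex type `V` (`0 < q < 1`):
`φ(o ↔ a)·φ(b ↔ a) ≤ φ(o ↔ a ↔ b)` for every weight vector. [cite: AyyerLinussonRavichandran2025, §7 eq. (13) (p. 22)]
[cite: Grimmett2006, §3.9 eq. (3.94) (pp. 63–65)] -/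
theorem hubUnder_of_edgeNegCorrAdjOn {q : ℝ} (hq0 : 0 < q) (hq1 : q < 1) (hNC : EdgeNegCorrAdjOn V q)
    (w : Sym2 V → unitInterval) (o a b : V) : HubUnder (rcMeasureW w q ∅) o a b := by
  haveI := isProbabilityMeasure_rcMeasureW w hq0 (∅ : Set V)
  unfold HubUnder
  rw [probReal_univ, one_mul]
  have key := hub_of_edgeNegCorrAdj_aux hq0 hq1 hNC _ w rfl a o b
  rw [clusterIn_mem_eq_openConn, clusterIn_mem_eq_openConn] at key
  have h1 : (openConn a o : Set (BondConfig V)) = openConn o a := by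
    ext ω; exact ⟨fun h => SimpleGraph.Reachable.symm h, fun h => SimpleGraph.Reachable.symm h⟩
  have h2 : (openConn a b : Set (BondConfig V)) = openConn b a := by
    ext ω; exact ⟨fun h => SimpleGraph.Reachable.symm h, fun h => SimpleGraph.Reachable.symm h⟩
  rwa [h1, h2] at key

/-- **`EdgeNegCorrAdjFK q → HubFK q`** (`0 < q < 1`). [cite: AyyerLinussonRavichandran2025, §7 eq. (13) (p. 22)] -/
theorem hubFK_of_edgeNegCorrAdjFK {q : ℝ} (hq0 : 0 < q) (hq1 : q < 1) (h : EdgeNegCorrAdjFK q) : HubFK q :=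
  fun n w o a b => hubUnder_of_edgeNegCorrAdjOn hq0 hq1 (h n) w o a b

/-- **Conjecture nodes: `EdgeNegCorrAdjFKLtOne → HubFKPos`** — the ADJACENT case of Grimmett's negative-correlation conjecture
(`0 < q < 1`) implies Ayyer–Linusson–Ravichandran's hub inequality (13) for every `q > 0` (`q ≥ 1`: FKG).
[cite: AyyerLinussonRavichandran2025, §7 eq. (13), Conj. 7.1 (pp. 22–23)] [cite: Grimmett2006, §3.9 (pp. 63–65)] -/
theorem hubFKPos_of_edgeNegCorrAdjFKLtOne (h : EdgeNegCorrAdjFKLtOne) : HubFKPos := by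
  intro q hq0
  by_cases hq1 : q < 1
  · exact hubFK_of_edgeNegCorrAdjFK hq0 hq1 (h q hq0 hq1)
  · exact hubFK_of_clusterAssocFK hq0 (clusterAssocFK_of_one_le (not_lt.1 hq1))

/-- **Conjecture nodes: `HubCovBoundFKLtOne → HubFKPos`** — the three-point UPPER bound on the hub covariance
(`(1 − q)·Cov(1{a↔o}, 1{a↔b}) ≤ φ(o ↔ b ↮ a)`, fk-3's node) implies the three-point LOWER bound `Cov ≥ 0` (ALR (13)).
[cite: AyyerLinussonRavichandran2025, §7 eq. (13) (p. 22)] [cite: Grimmett2006, §3.9 (pp. 63–65)] -/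
theorem hubFKPos_of_hubCovBoundFKLtOne (h : HubCovBoundFKLtOne) : HubFKPos :=
  hubFKPos_of_edgeNegCorrAdjFKLtOne (edgeNegCorrAdjFKLtOne_of_hubCovBoundFKLtOne h)

end FK

end Summit.CriticalPhenomena.PercolationContinuityZ3.Theorems
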